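import Summits.AtomisticToContinuum.BoseEinsteinCondensation.Theses.BECInfraredBound
import Summits.AtomisticToContinuum.BoseEinsteinCondensation.Theorems.GroundStateRigidity.Negative.LoadBearingHypotheses
import Literature.MathematicalPhysics.QuantumManyBody.BoseGasFreeProductState
import HarnessLib

/-!
# Disproof of `BecShellMass` (stmt-AtomisticToContinuum-0734) — findings

cdisprove seat `refuter-cdisprove-stmt-AtomisticToContinuum-0734-0`, cycle 1 (2026-08-17).  Crux decl
`Summit.AtomisticToContinuum.BoseEinsteinCondensation.Theses.BECInfraredBound.BecShellMass` (route
`BECInfraredBound`, rank 4): for every repulsive finite-range `v` there is `C = C(v) > 0` such that for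
`0 < ε < 1/4`, `ρ < ρ₀(v, ε)` and eventually all `N`, some slack `δ > 0` makes every Dirichlet trial state
with `energy ≤ E₀ + δ` carry `N_shell(εL) ≤ CεN` particles outside the inner cube `(εL, L-εL)³`,
`L = (N/ρ)^{1/3}`.  Everything below is kernel-checked (no `sorry`); axioms `propext`, `Classical.choice`,
`Quot.sound`.

## VERDICT (cycle 1): NO KILL.  The crux is almost certainly TRUE as stated.

Why it resists (paper): the shell `Λ ∖ (εL, L-εL)³` has volume fraction `s(ε) = 1 - (1-2ε)³ < 6ε`;
the thermodynamic limit is taken FIRST (`∀ᶠ N` inside `∀ ρ < ρ₀`), so for near-minimisers the shell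
mass per particle tends to the shell's share of the density, and density deviations from homogeneity
cost energy quadratically (LY lower bound in sub-boxes + Dyson/LSSY upper bound, relative slack
`η(ρ) → 0` as `ρ → 0`): `(x - s)² ≲ s·η` forces `x ≤ s + √(sη) = O(ε)` once `η(ρ₀) ≲ ε` — which is
exactly why `ρ₀` is allowed to depend on `ε`.  Formal corners checked: `E₀ < ⊤` eventually at low
density for EVERY admissible `v` (finite range ⇒ separated symmetrised bumps), `N = 0` harmless,
`ε ↑ 1/4` harmless, `ofReal` truncation harmless, quantifier order `∃ C ∀ ε ∃ ρ₀(ε)` is the weak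
(true) one.  Nearest print: LSSY2005 p. 36 (Dirichlet walls cost `∼ 1/L²` per particle and break
homogeneity only in the GP scaling, "can be treated with the methods of Chapter 7"), Thm 2.4 p. 19 and
Lemma 5.2 p. 37 (localization of energy); no printed counterexample (presearch in NOTES.md).

## INDEX

* §0 `shellMass`, `ShellBoundAt`, `becShellMass_iff` (the reading used), `shellMass_le` (`N_shell ≤ N`:
  the crux has content only for `ε < 1/C`), `shellBoundAt_of_one_le` (trivial for `Cε ≥ 1`).
* §1 MECHANISM of every witness below: `exists_shellLoaded` / `eventually_exists_shellLoaded` — in every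
  large box a Dirichlet product state with ALL particles in the corner cube `(0, εL)³`, `N_shell = N`;
  `not_shellBoundAt_of_groundStateEnergy_eq_top` — wherever `E₀(N,L) = ⊤` the one-box bound is FALSE
  (not vacuous) as soon as `Cε ≤ 1/2` (`exists_eps`: `ε = min (1/8) (1/(2C))`).
* §2 LOAD-BEARING `energy ≤ E₀ + δ`: `becShellMass_false_without_nearMin` (`v ≡ 0`).
* §3 LOAD-BEARING finite range (really: `E₀ < ⊤` eventually): `becShellMass_false_without_finiteRange`
  (`Measurable v` only admits `v ≡ ⊤`, `E₀ = ⊤` for `N ≥ 2`).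
* §4 LOAD-BEARING low density: `becShellMass_false_at_all_densities` (`∀ ρ > 0` is false: unit hard
  spheres at `ρ = 64`, `E₀ = ⊤` for `N ≥ 64` by the landed pigeonhole of `GroundStateRigidity/Negative`).
* §5 DECORATION `0 < ε`: `shellMass_eq_zero_of_nonpos`, `becShellMass_iff_withoutEpsPos`.
* Landed copy (no positive Theses conclusion): `Theorems/BecShellMass/Negative/LoadBearingHypotheses.lean`
  (namespace `…Theorems.BecShellMass.Negative`; proposal id in NOTES.md).

## DEAD attacks (one line each; details NOTES.md §Census)

* free gas `v ≡ 0` as a counterexample to the crux itself: Dirichlet ground state `∏ sin` has shell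
  fraction `1-(1-2ε+sin(2πε)/π)³ ≈ 4π²ε³ ≪ 6ε`, gap `3π²/L²` pins near-minimisers — no kill;
* vacuity/falsity via `E₀ = ⊤` for an ADMISSIBLE `v` at LOW density: impossible (finite range);
* hard cores / hard shells `⊤·1_{[0,R₀]}`, `⊤·1_{(R₁,R₀]}`: dilute hard spheres at low density,
  `scatteringLength ≤ R₀ < ⊤` — no kill;
* strengthenings `∃ ρ₀ ∀ ε` (ε-uniform density threshold), sharp `C < 6`, an `ε²`-law, relative slack
  `δ = E₀`: refuting or proving any of them needs many-body LOWER bounds on the shell mass of interacting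
  near-minimisers — out of reach here, recorded as open strengthenings, not claimed.

## Line `cell-jensen` (skeleton `Lines/cell_jensen.lean`; payload carried no `line`/targets) — cheap
stub attacks, all SURVIVE: `stub_boundaryLayerPoincare` is TRUE (`f(0)=0 ⇒ ∫₀ʷ|f|² ≤ (w²/2)∫|f′|²`,
six slabs, hypotheses `0 < w`, `2w ≤ L` not even needed); `stub_gridJensen`'s two-colour Jensen is
sound and `g(0)` is pinned by `E^Neu(0,ℓ) = E^Neu(1,ℓ) = 0` (constant Neumann state); `stub_cellMinorant`
is plausible provided the LY Neumann bound is used up to `4ρ₁` with superadditivity beyond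
(`k·64 ≥ 32(k+1) - 4`, `k ≥ 1`); joint sufficiency `becShellMass_of_stubs` is kernel-checked by the
planner.  No `stub-false` filed.

## Line `Sketch` (PICKED.md 2026-08-17T18:20Z, cards `noclumping-cover` / `noclumping-sum`; skeleton
`Lines/Sketch.lean` not yet visible to this seat) — paper pre-check of its announced stubs, all TRUE:
`stub_shellCover` (on `cellSet K s σ`, `X i j ≤ εL ≤ ms` with `sq < X i j` gives `q < m`, and
`X i j ≥ L-εL ≥ (K-m)s` with `X i j < s(q+1)` gives `K ≤ q+m`; grid hyperplanes are null, `ψ = 0` off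
`boxN`); `stub_outerCard` (`K³-(K-2m)³ = 6mK²-12m²K+8m³ ≤ 6mK² ⟺ 2m ≤ 3K`, implied by `2m ≤ K`; `m = 0`
fine); bookkeeping (`η = ε/2`, `M = δ = 1`, `2^k ≤ L√ρ < 2^{k+1}`, `m = ⌈ε2^k⌉`, `2m ≤ 2^k` needs only
`k ≥ 2` as `ε < 1/4`; `N_shell ≤ 6(ε+2^{-k})(1+ε/2)N + εN/2 ≤ 8εN` once `2^{-k} ≤ ε/12`) — consistent
with the in-tree `sum_massAverage_card_tsub_le_of_scatteringLength_pos` prefix (`energy ≤ E₀ + 1`, same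
`sideLength`).  The `a = 0` branch must cover every `v` with `scatteringLength v = 0` (not only `v ≡ 0`):
the card routes it through `LSSY2005_zeroScatteringLength_holds` (`v ∘ ‖·‖ = 0` a.e.) — the one place a
careless skeleton could smuggle a gap; to be checked against `Sketch.lean` when it registers.
-/

noncomputable section

namespace Summit.AtomisticToContinuum.BoseEinsteinCondensation.Cruxes.BecShellMass.Disproof

open Literature.MathematicalPhysics.QuantumManyBody.BoseGas
open Summit.AtomisticToContinuum.BoseEinsteinCondensation.Theses.BECInfraredBound
open Summit.AtomisticToContinuum.BoseEinsteinCondensation.Theorems.GroundStateRigidity.Negative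
open MeasureTheory Filter Set
open scoped ENNReal NNReal Topology

/-! ## 0. The shell-mass functional and the crux at one box -/

/-- `N_shell(w) = ∑ᵢ ∫ 1[xᵢ ∉ (w, L-w)³] |Ψ|²`: the expected number of particles outside the open inner
cube `(w, L - w)³` (the crux takes `w = εL`). [folklore] -/
def shellMass (N : ℕ) (L w : ℝ) (ψ : Config N → ℂ) : ℝ≥0∞ :=
  ∑ i : Fin N, ∫⁻ X, {x : EuclideanSpace ℝ (Fin 3) | ∀ j, x j ∈ Set.Ioo w (L - w)}ᶜ.indicator
      (fun _ => (1 : ℝ≥0∞)) (X i) * (‖ψ X‖₊ : ℝ≥0∞) ^ 2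

/-- The conclusion of the crux at ONE box `(v, N, L)` with constant `C` and shell parameter `ε`:
some slack `δ > 0` makes every `δ`-near-minimiser carry at most `CεN` particles in the shell. [folklore] -/
def ShellBoundAt (v : ℝ → ℝ≥0∞) (N : ℕ) (L C ε : ℝ) : Prop :=
  ∃ δ : ℝ≥0∞, 0 < δ ∧ ∀ Ψ : TrialState N L, energy v Ψ ≤ groundStateEnergy v N L + δ →
    shellMass N L (ε * L) Ψ.ψ ≤ ENNReal.ofReal (C * ε * N)

/-- The crux, by name, is the eventual one-box bound along the thermodynamic sequence (definitional
unfolding; fixes the reading used below). [folklore] -/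
theorem becShellMass_iff :
    BecShellMass ↔ ∀ v : ℝ → ℝ≥0∞, IsRepulsiveFiniteRange v → ∃ C : ℝ, 0 < C ∧
      ∀ ε : ℝ, 0 < ε → ε < 1 / 4 → ∃ ρ₀ : ℝ, 0 < ρ₀ ∧ ∀ ρ : ℝ, 0 < ρ → ρ < ρ₀ →
        ∀ᶠ N : ℕ in atTop, ShellBoundAt v N (sideLength ρ N) C ε :=
  Iff.rfl

/-- `N_shell ≤ N` for every normalised state: the crux has content only for `ε < 1/C`. [folklore] -/
theorem shellMass_le {N : ℕ} {L : ℝ} (w : ℝ) (Ψ : TrialState N L) : shellMass N L w Ψ.ψ ≤ N := by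
  unfold shellMass
  calc _ ≤ ∑ i : Fin N, ∫⁻ X, (‖Ψ.ψ X‖₊ : ℝ≥0∞) ^ 2 := by
        refine Finset.sum_le_sum fun i _ => lintegral_mono fun X => ?_
        calc _ ≤ 1 * (‖Ψ.ψ X‖₊ : ℝ≥0∞) ^ 2 := by
              gcongr
              exact Set.indicator_apply_le' (fun _ => le_rfl) (fun _ => zero_le_one)
          _ = _ := one_mul _
    _ = N := by simp [Ψ.norm_eq]

/-- Hence the one-box bound is TRIVIAL as soon as `Cε ≥ 1` (slack `δ = 1`): the crux's content is the
regime `ε < 1/C`. [folklore] -/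
theorem shellBoundAt_of_one_le {v : ℝ → ℝ≥0∞} {N : ℕ} {L C ε : ℝ} (h : 1 ≤ C * ε) :
    ShellBoundAt v N L C ε := by
  refine ⟨1, one_pos, fun Ψ _ => (shellMass_le _ Ψ).trans ?_⟩
  rw [← ENNReal.ofReal_natCast]
  exact ENNReal.ofReal_le_ofReal (by nlinarith [(Nat.cast_nonneg N : (0 : ℝ) ≤ N)])

/-! ## 1. Mechanism: shell-loaded product states

A Dirichlet trial state all of whose particles live in the corner cube `(0, w)³ ⊂ Λ_L` has `N_shell(w) = N`.
It is the coordinate product `∏_{(i,k)} g(x_{i,k})` of a normalised `C¹` profile `g` supported in `(0, w)`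
(the near-optimal sine profile of `BoseGasSineProfileIntegrals`, available for `w ≥ L₀`). -/

/-- A normalised `C¹` profile supported in `(0, w)` exists for all large `w`. [folklore] -/
theorem exists_profile : ∃ L₀ : ℝ, 0 < L₀ ∧ ∀ w : ℝ, L₀ ≤ w → ∃ g : ℝ → ℝ, ContDiff ℝ 1 g ∧
    HasCompactSupport g ∧ (∀ t, t ∉ Ioo 0 w → g t = 0) ∧ ∫ t, g t ^ 2 = 1 := by
  obtain ⟨L₀, hL₀, H⟩ := exists_nearOptimal_profile one_pos
  refine ⟨L₀, hL₀, fun w hw => ?_⟩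
  obtain ⟨g, hgc, hgs, hgz, -, hg1, -⟩ := H w hw
  exact ⟨g, hgc, hgs, hgz, hg1⟩

/-- **Shell-loaded product state.** From a normalised `C¹` profile supported in `(0, w)`, `w ≤ L`, the
product `Ψ(X) = ∏_{(i,k)} g(x_{i,k})` is a Dirichlet trial state of `N` bosons in `Λ_L` with all its mass
in `(0,w)^{3N}`, hence `N_shell(w) = N`. [folklore] -/
theorem exists_shellLoaded {L w : ℝ} (hwL : w ≤ L) {g : ℝ → ℝ} (hgc : ContDiff ℝ 1 g)
    (hgs : HasCompactSupport g) (hgz : ∀ t, t ∉ Ioo 0 w → g t = 0) (hg1 : ∫ t, g t ^ 2 = 1)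
    (N : ℕ) : ∃ Ψ : TrialState N L, shellMass N L w Ψ.ψ = N := by
  classical
  set F : Config N → ℝ := fun X => ∏ p : Fin N × Fin 3, g (X p.1 p.2) with hF
  have hFc : ContDiff ℝ 1 F := contDiff_prod fun p _ =>
    hgc.comp ((EuclideanSpace.proj p.2).comp (ContinuousLinearMap.proj (R := ℝ) p.1) :
      Config N →L[ℝ] ℝ).contDiff
  set ψ : Config N → ℂ := fun X => ((F X : ℝ) : ℂ) with hψ
  have hψc : ContDiff ℝ 1 ψ := Complex.ofRealCLM.contDiff.comp hFc
  have hint_g2 : Integrable fun t => g t ^ 2 := by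
    have h : Integrable (fun t => g t * g t) :=
      (hgc.continuous.mul hgc.continuous).integrable_of_hasCompactSupport hgs.mul_right
    simpa [pow_two] using h
  have hnorm : ∫⁻ X, ((‖ψ X‖₊ : ℝ≥0∞)) ^ 2 = 1 := by
    have hpt : ∀ X, ((‖ψ X‖₊ : ℝ≥0∞)) ^ 2 =
        ENNReal.ofReal (∏ p : Fin N × Fin 3, g (X p.1 p.2) ^ 2) := by
      intro X
      rw [ennnorm_sq_eq_ofReal, hψ]
      simp only [Complex.norm_real, Real.norm_eq_abs, sq_abs, hF, ← Finset.prod_pow]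
    simp_rw [hpt]
    rw [lintegral_ofReal_prod_coord (fun _ t => g t ^ 2) (fun _ _ => sq_nonneg _) fun _ => hint_g2]
    simp [hg1]
  have hzero : ∀ X : Config N, (∃ i k, X i k ∉ Ioo (0 : ℝ) w) → ψ X = 0 := by
    rintro X ⟨i, k, hik⟩
    have : F X = 0 := Finset.prod_eq_zero (Finset.mem_univ (i, k)) (hgz _ hik)
    simp [hψ, this]
  let Ψ : TrialState N L :=
    { ψ := ψ
      contDiff := hψc
      eq_zero := fun X hX => by
        apply hzero
        by_contra hall
        push Not at hall
        exact hX fun i k => Ioo_subset_Ioo_right hwL (hall i k)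
      symm := fun σ X => by
        simp only [hψ, hF, Function.comp_apply]
        congr 1
        exact Equiv.prod_comp (σ.prodCongr (Equiv.refl (Fin 3))) (fun q : Fin N × Fin 3 => g (X q.1 q.2))
      norm_eq := hnorm }
  refine ⟨Ψ, ?_⟩
  have hterm : ∀ i : Fin N, (∫⁻ X, {x : EuclideanSpace ℝ (Fin 3) | ∀ j, x j ∈ Set.Ioo w (L - w)}ᶜ.indicator
      (fun _ => (1 : ℝ≥0∞)) (X i) * (‖ψ X‖₊ : ℝ≥0∞) ^ 2) = 1 := by
    intro i
    refine Eq.trans (lintegral_congr fun X => ?_) hnorm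
    by_cases hX : ψ X = 0
    · simp [hX]
    · have hin : ∀ i k, X i k ∈ Ioo (0 : ℝ) w := by
        by_contra hall
        push Not at hall
        exact hX (hzero X hall)
      have hnot : X i ∉ {x : EuclideanSpace ℝ (Fin 3) | ∀ j, x j ∈ Set.Ioo w (L - w)} := by
        intro hmem
        have hmem' : ∀ j, X i j ∈ Set.Ioo w (L - w) := hmem
        exact lt_irrefl _ ((hmem' 0).1.trans (hin i 0).2)
      simp only [Set.indicator_of_mem (Set.mem_compl hnot), one_mul]
  calc shellMass N L w Ψ.ψ = ∑ i : Fin N, (1 : ℝ≥0∞) := Finset.sum_congr rfl fun i _ => hterm i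
    _ = N := by simp

/-- Along the thermodynamic sequence `L_N = (N/ρ)^{1/3} → ∞`, shell-loaded states with `N_shell(εL_N) = N`
exist for all large `N` (any `ρ > 0`, `0 < ε ≤ 1`). [folklore] -/
theorem eventually_exists_shellLoaded {ρ ε : ℝ} (hρ : 0 < ρ) (hε : 0 < ε) (hε1 : ε ≤ 1) :
    ∀ᶠ N : ℕ in atTop, ∃ Ψ : TrialState N (sideLength ρ N),
      shellMass N (sideLength ρ N) (ε * sideLength ρ N) Ψ.ψ = N := by
  obtain ⟨L₀, hL₀, H⟩ := exists_profile
  filter_upwards [(tendsto_sideLength_atTop hρ).eventually_ge_atTop (L₀ / ε)] with N hN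
  have hL : 0 ≤ sideLength ρ N := (div_pos hL₀ hε).le.trans hN
  have hw : L₀ ≤ ε * sideLength ρ N := by
    rw [div_le_iff₀ hε] at hN
    linarith
  obtain ⟨g, hgc, hgs, hgz, hg1⟩ := H _ hw
  exact exists_shellLoaded (mul_le_of_le_one_left hL hε1) hgc hgs hgz hg1 N

/-- Arithmetic of the witness: `Cε ≤ 1/2` and `N ≥ 1` give `ofReal (CεN) < N`. [folklore] -/
theorem ofReal_lt_of_half {N : ℕ} (hN : 0 < N) {C ε : ℝ} (hCε : C * ε ≤ 1 / 2) :
    ENNReal.ofReal (C * ε * N) < (N : ℝ≥0∞) := by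
  rw [← ENNReal.ofReal_natCast N]
  have hNr : (0 : ℝ) < N := by exact_mod_cast hN
  exact (ENNReal.ofReal_lt_ofReal_iff hNr).2 (by nlinarith)

/-- The constant-killing shell parameter: for `C > 0`, `ε = min (1/8) (1/(2C))` has `0 < ε < 1/4`,
`ε ≤ 1` and `Cε ≤ 1/2`. [folklore] -/
theorem exists_eps {C : ℝ} (hC : 0 < C) :
    ∃ ε : ℝ, 0 < ε ∧ ε < 1 / 4 ∧ ε ≤ 1 ∧ C * ε ≤ 1 / 2 := by
  refine ⟨min (1 / 8) (1 / (2 * C)), lt_min (by norm_num) (by positivity),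
    (min_le_left _ _).trans_lt (by norm_num), (min_le_left _ _).trans (by norm_num), ?_⟩
  calc C * min (1 / 8) (1 / (2 * C)) ≤ C * (1 / (2 * C)) :=
        mul_le_mul_of_nonneg_left (min_le_right _ _) hC.le
    _ = 1 / 2 := by field_simp

/-- **`E₀ = ⊤` kills the one-box bound** (it is NOT vacuously true there, it is false there): with
`E₀(N, L) = ⊤` every trial state is a near-minimiser at every slack, in particular a shell-loaded one,
whose `N_shell = N > CεN` once `Cε ≤ 1/2`.  So every proof must show `E₀ < ⊤` eventually (hard cores
fit at `ρ < ρ₀`). [folklore] -/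
theorem not_shellBoundAt_of_groundStateEnergy_eq_top {v : ℝ → ℝ≥0∞} {N : ℕ} (hN : 0 < N)
    {L C ε : ℝ} (hCε : C * ε ≤ 1 / 2) (hE : groundStateEnergy v N L = ⊤)
    (hΨ : ∃ Ψ : TrialState N L, shellMass N L (ε * L) Ψ.ψ = N) : ¬ ShellBoundAt v N L C ε := by
  rintro ⟨δ, -, h⟩
  obtain ⟨Ψ, hΨ⟩ := hΨ
  have hb := h Ψ (by rw [hE, top_add]; exact le_top)
  rw [hΨ] at hb
  exact (not_le.2 (ofReal_lt_of_half hN hCε)) hb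

/-! ## 2. LOAD-BEARING: the near-minimiser hypothesis

Dropping `energy v Ψ ≤ E₀ + δ` (a bound for ALL Dirichlet trial states) is false already for the free
gas `v ≡ 0`: shell-loaded states exist in every large box. -/

/-- `BecShellMass` with the near-minimiser hypothesis (and its slack `δ`) deleted. [folklore] -/
def BecShellMassWithoutNearMin : Prop :=
  ∀ v : ℝ → ℝ≥0∞, IsRepulsiveFiniteRange v → ∃ C : ℝ, 0 < C ∧ ∀ ε : ℝ, 0 < ε → ε < 1 / 4 →
    ∃ ρ₀ : ℝ, 0 < ρ₀ ∧ ∀ ρ : ℝ, 0 < ρ → ρ < ρ₀ → ∀ᶠ N : ℕ in Filter.atTop,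
      ∀ Ψ : TrialState N (sideLength ρ N),
        ∑ i : Fin N, ∫⁻ X, {x : EuclideanSpace ℝ (Fin 3) | ∀ j, x j ∈
            Set.Ioo (ε * sideLength ρ N) (sideLength ρ N - ε * sideLength ρ N)}ᶜ.indicator
            (fun _ => (1 : ℝ≥0∞)) (X i) * (‖Ψ.ψ X‖₊ : ℝ≥0∞) ^ 2 ≤ ENNReal.ofReal (C * ε * N)

/-- **Near-minimality is load-bearing**: `¬ BecShellMassWithoutNearMin`, witnessed at `v ≡ 0` by the
shell-loaded product states (`ε = min (1/8) (1/(2C))`, any density). [folklore] -/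
theorem becShellMass_false_without_nearMin : ¬ BecShellMassWithoutNearMin := by
  intro h
  obtain ⟨C, hC, h⟩ := h (fun _ => 0) ⟨measurable_const, 0, fun _ _ => rfl⟩
  obtain ⟨ε, hε, hε4, hε1, hCε⟩ := exists_eps hC
  obtain ⟨ρ₀, hρ₀, h⟩ := h ε hε hε4
  have h' := h (ρ₀ / 2) (half_pos hρ₀) (half_lt_self hρ₀)
  obtain ⟨N, hN, ⟨Ψ, hΨ⟩, hb⟩ := ((eventually_gt_atTop 0).and
    ((eventually_exists_shellLoaded (half_pos hρ₀) hε hε1).and h')).exists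
  have hb' : shellMass N (sideLength (ρ₀ / 2) N) (ε * sideLength (ρ₀ / 2) N) Ψ.ψ ≤
      ENNReal.ofReal (C * ε * N) := hb Ψ
  rw [hΨ] at hb'
  exact (not_le.2 (ofReal_lt_of_half hN hCε)) hb'

/-! ## 3. LOAD-BEARING: finite range (through `E₀ < ⊤`)

With `IsRepulsiveFiniteRange v` weakened to `Measurable v`, the constant potential `v ≡ ⊤` is admitted;
for `N ≥ 2` every trial state has infinite energy (`interaction_top_eq_top`), `E₀ = ⊤`, every state is a
near-minimiser, and §1 applies. -/

/-- `BecShellMass` with `IsRepulsiveFiniteRange v` weakened to `Measurable v`. [folklore] -/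
def BecShellMassWithoutFiniteRange : Prop :=
  ∀ v : ℝ → ℝ≥0∞, Measurable v → ∃ C : ℝ, 0 < C ∧ ∀ ε : ℝ, 0 < ε → ε < 1 / 4 →
    ∃ ρ₀ : ℝ, 0 < ρ₀ ∧ ∀ ρ : ℝ, 0 < ρ → ρ < ρ₀ → ∀ᶠ N : ℕ in Filter.atTop, ∃ δ : ℝ≥0∞, 0 < δ ∧
      ∀ Ψ : TrialState N (sideLength ρ N),
        energy v Ψ ≤ groundStateEnergy v N (sideLength ρ N) + δ →
        ∑ i : Fin N, ∫⁻ X, {x : EuclideanSpace ℝ (Fin 3) | ∀ j, x j ∈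
            Set.Ioo (ε * sideLength ρ N) (sideLength ρ N - ε * sideLength ρ N)}ᶜ.indicator
            (fun _ => (1 : ℝ≥0∞)) (X i) * (‖Ψ.ψ X‖₊ : ℝ≥0∞) ^ 2 ≤ ENNReal.ofReal (C * ε * N)

/-- **Finite range is load-bearing**: `¬ BecShellMassWithoutFiniteRange`, witnessed at `v ≡ ⊤`
(`E₀ = ⊤` for all `N ≥ 2`, shell-loaded states). [folklore] -/
theorem becShellMass_false_without_finiteRange : ¬ BecShellMassWithoutFiniteRange := by
  intro h
  obtain ⟨C, hC, h⟩ := h (fun _ => ⊤) measurable_const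
  obtain ⟨ε, hε, hε4, hε1, hCε⟩ := exists_eps hC
  obtain ⟨ρ₀, hρ₀, h⟩ := h ε hε hε4
  have h' := h (ρ₀ / 2) (half_pos hρ₀) (half_lt_self hρ₀)
  obtain ⟨N, hN2, hΨ, hb⟩ := ((eventually_ge_atTop 2).and
    ((eventually_exists_shellLoaded (half_pos hρ₀) hε hε1).and h')).exists
  refine not_shellBoundAt_of_groundStateEnergy_eq_top (v := fun _ => ⊤) (by omega) hCε ?_ hΨ hb
  exact groundStateEnergy_eq_top_of_forall fun Ψ =>
    energy_eq_top_of_interaction_eq_top _ Ψ fun X _ => interaction_top_eq_top hN2 X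

/-! ## 4. LOAD-BEARING: low density

With `∃ ρ₀ > 0, ∀ ρ < ρ₀` replaced by `∀ ρ > 0`, the admissible unit hard spheres `⊤·1_{[0,1]}` at density
`ρ = 64` have `E₀(N, (N/64)^{1/3}) = ⊤` for all `N ≥ 64` (pigeonhole, landed for crux `GroundStateRigidity`:
`groundStateEnergy_hardSphere_eq_top`, `ceil_cube_lt`), so again every state is a near-minimiser. -/

/-- `BecShellMass` with the low-density hypothesis deleted (`∀ ρ > 0`). [folklore] -/
def BecShellMassAtAllDensities : Prop :=
  ∀ v : ℝ → ℝ≥0∞, IsRepulsiveFiniteRange v → ∃ C : ℝ, 0 < C ∧ ∀ ε : ℝ, 0 < ε → ε < 1 / 4 →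
    ∀ ρ : ℝ, 0 < ρ → ∀ᶠ N : ℕ in Filter.atTop, ∃ δ : ℝ≥0∞, 0 < δ ∧
      ∀ Ψ : TrialState N (sideLength ρ N),
        energy v Ψ ≤ groundStateEnergy v N (sideLength ρ N) + δ →
        ∑ i : Fin N, ∫⁻ X, {x : EuclideanSpace ℝ (Fin 3) | ∀ j, x j ∈
            Set.Ioo (ε * sideLength ρ N) (sideLength ρ N - ε * sideLength ρ N)}ᶜ.indicator
            (fun _ => (1 : ℝ≥0∞)) (X i) * (‖Ψ.ψ X‖₊ : ℝ≥0∞) ^ 2 ≤ ENNReal.ofReal (C * ε * N)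

/-- **Low density is load-bearing**: `¬ BecShellMassAtAllDensities`, witnessed by unit hard spheres at
`ρ = 64` (`E₀ = ⊤` for `N ≥ 64`, shell-loaded states). [folklore] -/
theorem becShellMass_false_at_all_densities : ¬ BecShellMassAtAllDensities := by
  intro h
  obtain ⟨C, hC, h⟩ := h _ isRepulsiveFiniteRange_hardSphere
  obtain ⟨ε, hε, hε4, hε1, hCε⟩ := exists_eps hC
  have h' := h ε hε hε4 64 (by norm_num)
  obtain ⟨N, hN, hΨ, hb⟩ := ((eventually_ge_atTop 64).and
    ((eventually_exists_shellLoaded (by norm_num : (0 : ℝ) < 64) hε hε1).and h')).exists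
  exact not_shellBoundAt_of_groundStateEnergy_eq_top (by omega) hCε
    (groundStateEnergy_hardSphere_eq_top (ceil_cube_lt hN)) hΨ hb

/-! ## 5. DECORATION: the hypothesis `0 < ε` is unnecessary

For `ε ≤ 0` the inner cube `(εL, L - εL)³` contains the whole open box, so `N_shell = 0` for every
Dirichlet trial state and the bound holds with any `C ≥ 0`… in `ℝ≥0∞` even for `CεN < 0`
(`ofReal` truncates).  Hence `BecShellMass` is equivalent to its version without `0 < ε`. -/

/-- For `ε ≤ 0` (and `L ≥ 0`) the shell mass of a Dirichlet trial state vanishes. [folklore] -/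
theorem shellMass_eq_zero_of_nonpos {N : ℕ} {L ε : ℝ} (hε : ε ≤ 0) (hL : 0 ≤ L) (Ψ : TrialState N L) :
    shellMass N L (ε * L) Ψ.ψ = 0 := by
  unfold shellMass
  refine Finset.sum_eq_zero fun i _ => ?_
  have hpt : ∀ X, {x : EuclideanSpace ℝ (Fin 3) | ∀ j, x j ∈ Set.Ioo (ε * L) (L - ε * L)}ᶜ.indicator
      (fun _ => (1 : ℝ≥0∞)) (X i) * (‖Ψ.ψ X‖₊ : ℝ≥0∞) ^ 2 = 0 := by
    intro X
    by_cases hX : Ψ.ψ X = 0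
    · simp [hX]
    · have hXb : X ∈ boxN N L := by
        by_contra hc
        exact hX (Ψ.eq_zero X hc)
      have hin : X i ∈ {x : EuclideanSpace ℝ (Fin 3) | ∀ j, x j ∈ Set.Ioo (ε * L) (L - ε * L)} := by
        intro j
        have hj : X i j ∈ Set.Ioo 0 L := hXb i j
        have hεL : ε * L ≤ 0 := by nlinarith
        exact ⟨by linarith [hj.1], by linarith [hj.2]⟩
      have hnc : X i ∉ ({x : EuclideanSpace ℝ (Fin 3) | ∀ j, x j ∈ Set.Ioo (ε * L) (L - ε * L)})ᶜ :=
        fun hc => hc hin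
      rw [Set.indicator_of_notMem hnc, zero_mul]
  simp_rw [hpt]
  exact lintegral_zero

/-- `BecShellMass` with the hypothesis `0 < ε` deleted. [folklore] -/
def BecShellMassWithoutEpsPos : Prop :=
  ∀ v : ℝ → ℝ≥0∞, IsRepulsiveFiniteRange v → ∃ C : ℝ, 0 < C ∧ ∀ ε : ℝ, ε < 1 / 4 →
    ∃ ρ₀ : ℝ, 0 < ρ₀ ∧ ∀ ρ : ℝ, 0 < ρ → ρ < ρ₀ → ∀ᶠ N : ℕ in Filter.atTop, ∃ δ : ℝ≥0∞, 0 < δ ∧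
      ∀ Ψ : TrialState N (sideLength ρ N),
        energy v Ψ ≤ groundStateEnergy v N (sideLength ρ N) + δ →
        ∑ i : Fin N, ∫⁻ X, {x : EuclideanSpace ℝ (Fin 3) | ∀ j, x j ∈
            Set.Ioo (ε * sideLength ρ N) (sideLength ρ N - ε * sideLength ρ N)}ᶜ.indicator
            (fun _ => (1 : ℝ≥0∞)) (X i) * (‖Ψ.ψ X‖₊ : ℝ≥0∞) ^ 2 ≤ ENNReal.ofReal (C * ε * N)

/-- **`0 < ε` is decoration**: the crux is equivalent to its version for all `ε < 1/4`. [folklore] -/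
theorem becShellMass_iff_withoutEpsPos : BecShellMass ↔ BecShellMassWithoutEpsPos := by
  constructor
  · intro h v hv
    obtain ⟨C, hC, h⟩ := h v hv
    refine ⟨C, hC, fun ε hε4 => ?_⟩
    by_cases hε : 0 < ε
    · exact h ε hε hε4
    · refine ⟨1, one_pos, fun ρ hρ _ => Eventually.of_forall fun N => ⟨1, one_pos, fun Ψ _ => ?_⟩⟩
      have hL : 0 ≤ sideLength ρ N := Real.rpow_nonneg (div_nonneg (Nat.cast_nonneg _) hρ.le) _
      have h0 := shellMass_eq_zero_of_nonpos (not_lt.1 hε) hL Ψ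
      unfold shellMass at h0
      rw [h0]
      exact zero_le
  · intro h v hv
    obtain ⟨C, hC, h⟩ := h v hv
    exact ⟨C, hC, fun ε _ hε4 => h ε hε4⟩

end Summit.AtomisticToContinuum.BoseEinsteinCondensation.Cruxes.BecShellMass.Disproof

end
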